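import Literature.MathematicalPhysics.QuantumFieldTheory.Balaban1983to89.B8Eq191FlatDirichletCoercive
import Literature.MathematicalPhysics.QuantumFieldTheory.Balaban1983to89.B8Eq191FlatTowerGram

/-!
# `Balaban1983to89.B8Eq191FlatDirichletConjugation` — [Balaban1985RegularSpaces] (1.91)∕(1.101) pp. 91–93 AT `U₀ = 1` WITH DIRICHLET CONDITIONS: THE EXPONENTIAL
# CONJUGATION of the flat multi-level form ([B5] p. 36 «e^{−⟨q,x⟩}Δ_a e^{⟨q,x⟩} − Δ_a is a small perturbation of Δ_a», in the MULTI-SCALE weights of [4] (3.47) ∕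
# the block distance [B6] (2.46)) and THE WEIGHTED-`ℓ²` DECAY (Agmon) ESTIMATE for the flat Dirichlet multi-level Green's function `T⁻¹` on the explicit kernel of
# `B8Eq191FlatDirichletForm`; instance at the concrete cube member `{□_j}` of (1.131)

statement-level skeleton of published theorems with citation tags; proofs where landed; nothing here is a claim about the
Yang–Mills mass gap

T. Bałaban, *Spaces of regular gauge field configurations on a lattice and gauge fixing conditions*, Commun. Math. Phys. **99** (1985) 75–102
`[Balaban1985RegularSpaces]` ("B8"): (1.91) p. 91, (1.101) p. 93 («G′ is a bounded operator from a space with the norm |·|₍₋₂₎ into a space with the norm |·|»),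
(1.131) p. 99; [4] = T. Bałaban, *Propagators for lattice gauge theories in a background field*, Commun. Math. Phys. **99** (1985) 389–434
`[Balaban1985BackgroundPropagators]`, Thm 3.1 (3.42)–(3.47) pp. 397–398; [B5] = T. Bałaban, *Propagators and renormalization transformations for lattice gauge
theories. I*, Commun. Math. Phys. **95** (1984) 17–40 `[Balaban1984PropagatorsI]`, p. 36 (PDF 20, verbatim): «Probably the simplest proof of the exponential decay
properties can be obtained by … proving that the operator e^{−⟨q,x⟩}Δ_a e^{⟨q,x⟩} − Δ_a is a small perturbation of Δ_a for vectors q ∈ R^d sufficiently small»,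
(1.90) p. 33, (1.114) p. 36, (1.126) p. 38; [B6] = T. Bałaban, *… II*, Commun. Math. Phys. **96** (1984) 223–250 `[Balaban1984PropagatorsII]`, p. 228 («G(Ω) =
(ΩΔ_aΩ)⁻¹ … minor and obvious changes»), (2.46) p. 231 (the block distance `d(y,y′)`), Lemma 2.1 (2.61) p. 234, (2.26)–(2.27) p. 235.

CITATION HEADER (lean-in-tree rule).  Cell `pub-ymgap` (YM Track A, HUMAN RULING D-0062), DAG node N05 = [B8], seat `pub-ymgap-dag-n05-c` (g8; bus INBOX l.19153
INTENT-2; programme (R1′) of n05-e g4's HANDOFF = [4] Thms 3.1∕3.2 at `U₀ = 1` with Dirichlet conditions, the three REAL families of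
`B8Prop6CubeMemberFlatScalar.prop6_cubeMember_flat_of_real`; lit-balaban desk ME #24 «FREE for base n05-c»).  Brick 1 (`B8Eq191FlatDirichletCoercive`, p525988)
proved the `k`-uniform weighted lower bound `Σ_x ω(x)v(x)² ≤ ⟨v, Kv⟩`, `ω(x) = Σ_j[Bʲ(x)∈Λ_j]·min{8,a′_j}·(Lʲη)⁻²`.  THIS FILE is brick 2: the multi-scale form of
[B5]'s exponential conjugation — the decay mechanism of (1.101) — stated as a weighted Schur test, so that the admissible exponents `ρ` are exactly the
`δ`-multiples of a distance that costs `L⁻ʲ` per bond at level `j` and `O(1)` per tower block ([B6] (2.46)).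

WHAT THIS FILE PROVES (theorems only; 0 `def`; inputs BY NAME: brick 1's `weighted_coercive_flatDirichlet`∕`sum_block_eq`∕`towerBlock_subset_cube`, n05-e's
`B8Eq191FlatTowerGram.flatKernel_symm`, `B8Eq191FlatLettersCubeMember.towers_disjoint_cube`, `B8CubeMemberZd.hpart_cubeLam`).
* §1 GENERIC (any finite `S`, any kernel symmetric on `S`): ★ `conjForm_eq_cosh` ∕ `conjForm_eq_add_coshDefect` — `⟨e^{ρ}u, K e^{−ρ}u⟩ = ⟨u,Ku⟩ +
  Σ u_xK(x,z)(cosh(ρ_x − ρ_z) − 1)u_z` (the first-order terms of a symmetric kernel cancel; defect of second order).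
* §2 ★ `coshDefect_le_of_rowBound` — the WEIGHTED SCHUR TEST: a row condition `Σ_z|K(x,z)|(cosh(ρ_x−ρ_z) − 1) ≤ θ·ω(x)` bounds the defect by `θ·Σ ω u²`.
* §3 ★ `conjForm_ge` (`(1 − θ)Σ ω u² ≤ ⟨e^{ρ}u, K e^{−ρ}u⟩` from a weighted lower bound + the row condition), ★★ `agmon_solve` (for `Kg = f` on `S`, `ω > 0`, `θ < 1`:
  `(1 − θ)²·Σ ω e^{2ρ} g² ≤ Σ ω⁻¹ e^{2ρ} f²` — Cauchy–Schwarz on `⟨e^{ρ}g, e^{ρ}f⟩`).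
* §4 THE FLAT DIRICHLET MULTI-LEVEL KERNEL (n05-e's letter `K`∕`hK` verbatim): `siteWeight_sum_eq` (brick 1's bound IS `Σ_x ω(x)v(x)²`), ★★ `rowBound_flatDirichlet`
  — under «tower blocks lie in S», «every site of S is in a tower block», and an exponent with `4d(cosh Δ_bond ρ − 1) ≤ θ·min{8,a′_j}·L^{−2j}` across the bonds at a
  level-`j` site (`hρ1`) and `2a′_j(cosh Δ_block ρ − 1) ≤ θ·min{8,a′_j}` on each tower block (`hρ2`), the row condition holds with brick 1's weight `ω`
  (diagonal killed by `cosh 0 = 1`; `2d` bonds paid by the covering level; each block's `L^{dj}` sites counted by brick 1's chart).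
* §5 ★★ `conj_coercive_flatDirichlet` (`(1 − θ)Σ_S ω u² ≤ ⟨e^{ρ}u, K e^{−ρ}u⟩`), `siteWeight_pos`, ★★★ **`agmon_solve_flatDirichlet`** (`Kg = f` on `S`, `a_j > 0`,
  `0 ≤ θ < 1` ⇒ `(1 − θ)²·Σ_S ω e^{2ρ} g² ≤ Σ_S ω⁻¹ e^{2ρ} f²`), `cover_cubeMember` (every site of `□₀` lies in a truncation-`n` tower block), ★★
  **`agmon_solve_cubeMember`** — the decay estimate for the matrix of `prop6_cubeMember_flat_of_real` (letters `S = □₀`, `K` at `(η, L, n, cubeLamS, w)`), its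
  three geometric hypotheses DISCHARGED.

HONEST SCOPE.  (i) Form inequalities + Cauchy–Schwarz; the exponent `ρ` is a HYPOTHESIS constrained by `hρ1`∕`hρ2` — the construction of an admissible
`ρ = δ·dist` (the [B6] (2.46) block distance on the cube member) and the `ℓ² → ℓ^∞` step with its volume bookkeeping are NOT here: this is NOT (1.101), NOT (1.92),
NOT (1.98).  (ii) LOCATED (bus l.19153, «LOCATED-ρ»): the `k`-uniform sup bound will need a MARGIN THRESHOLD on the cube member's collar width `ρ = R₁M₁`
([B6] (2.2) «R is a big positive integer fixed later»; B8 p. 98 «R₁, M₁ are smallest integers for which all the theorems of [2, 4] are valid»), which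
`CarriersB8Cube.CubeB8` (`L ≤ ρ`) does not display; nothing in this file depends on it.  (iii) As brick 1: the Dirichlet-on-`□₀ᶜ` matrix is the tree's consumer-side
carrier (n05-e g3∕g4), licensed by [B6] p. 228; print's Prop. 6 runs Thm 4 on the torus with `Λ′₀ = T∖□₁`.  Count-neutral; N05 NOT discharged; one finite `T⁴`
programme at fixed `ε`, Bałaban as printed; nothing continuum ∕ ℝ⁴ ∕ OS ∕ mass-gap ∕ Clay.  No `sorry`, no `def`, no `instance`, no `notation`.  Unit
`pub-ymgap-dag-n05-c` (g8), 2026-08-27.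

RELATED IN THE TREE, NOT DUPLICATED (searched 2026-08-27T11:15Z: `rg -l 'CombesThomas|cosh' Balaban1983to89/B5CombesThomas*.lean B6Cov2110CombesThomas.lean`):
`B5CombesThomasKernel.kernel_conj_defect_le` ∕ `weighted_solve` ∕ `local_decay` (ONE-scale conjugation with a uniform row profile `δ·S·‖u‖²` and the (1.90)-shape
coercivity — the pattern followed here; not multi-level, not weighted), `B5CombesThomasTorus.conjM0_ge` ∕ `solve_bound` (the local stencil on the torus),
`T4ConstrainedAgmonD` (Agmon estimate on the T⁴ programme's constrained block tangent, other carrier); none is keyed on the `ℤᵈ`∕`blockMap`∕`Finset` letters of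
`B8Eq191FlatDirichletForm` or carries a site-dependent weight.
-/

noncomputable section

namespace Literature.MathematicalPhysics.QuantumFieldTheory.Balaban1983to89.B8Eq191FlatDirichletConjugation

open Finset
open B7Prop1Explicit (e)
open Literature.MathematicalPhysics.QuantumLattice (blockMap blockBase)
open B8Eq191FlatDirichletCoercive (weighted_coercive_flatDirichlet sum_block_eq towerBlock_subset_cube)
open B8Eq191FlatTowerGram (flatKernel_symm)
open B8Ineq132 (Under)
open B8Eq131Cubes (cube mem_cube_iff)
open B8Eq131CubesAdmissible (cubeFam cubeFam_false_of_le)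
open B8CubeMemberZd (cubeLamS cubeLamS_of_lt cubeLamS_self inBox_sq_of_mem_cubeLamS hpart_cubeLam inBox_tower_iff_under)
open B8Eq191FlatLettersCubeMember (under_iff_blockMap_eq cubeFam_antitone towers_disjoint_cube)

variable {d : ℕ}

/-! ## §1 The exponential conjugation of a symmetric form: `⟨e^{ρ}u, K e^{−ρ}u⟩ = ⟨u,Ku⟩ + Σ u_x K(x,z)(cosh(ρ_x − ρ_z) − 1)u_z` -/

/-- **CONJUGATION IDENTITY** ([B5] p. 36 «e^{−⟨q,x⟩}Δ_a e^{⟨q,x⟩} − Δ_a»: the first-order terms of a SYMMETRIC kernel cancel): for `K` symmetric on a finite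
`S` and any real `ρ`, `u`,  `Σ_{x,z∈S} (e^{ρ_x}u_x)K(x,z)(e^{−ρ_z}u_z) = Σ_{x,z∈S} u_xK(x,z)cosh(ρ_x − ρ_z)u_z`.
[cite: Balaban1984PropagatorsI, p.36 (exponential conjugation); Balaban1985BackgroundPropagators, (3.47) p.398] -/
theorem conjForm_eq_cosh {α : Type*} (S : Finset α) (K : α → α → ℝ) (hK : ∀ x ∈ S, ∀ z ∈ S, K x z = K z x) (ρ u : α → ℝ) :
    ∑ x ∈ S, ∑ z ∈ S, (Real.exp (ρ x) * u x) * K x z * (Real.exp (-ρ z) * u z)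
      = ∑ x ∈ S, ∑ z ∈ S, u x * K x z * Real.cosh (ρ x - ρ z) * u z := by
  have hterm : ∀ x z, (Real.exp (ρ x) * u x) * K x z * (Real.exp (-ρ z) * u z) = u x * K x z * Real.exp (ρ x - ρ z) * u z := by
    intro x z
    rw [sub_eq_add_neg, Real.exp_add]
    ring
  simp_rw [hterm]
  -- symmetrise: the sum equals the same sum with `exp (ρ z − ρ x)`
  have hswap : ∑ x ∈ S, ∑ z ∈ S, u x * K x z * Real.exp (ρ x - ρ z) * u z
      = ∑ x ∈ S, ∑ z ∈ S, u x * K x z * Real.exp (ρ z - ρ x) * u z := by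
    rw [Finset.sum_comm]
    exact Finset.sum_congr rfl fun x hx => Finset.sum_congr rfl fun z hz => by rw [hK z hz x hx]; ring
  have h2 : ∑ x ∈ S, ∑ z ∈ S, u x * K x z * Real.exp (ρ x - ρ z) * u z
        + ∑ x ∈ S, ∑ z ∈ S, u x * K x z * Real.exp (ρ z - ρ x) * u z
      = 2 * ∑ x ∈ S, ∑ z ∈ S, u x * K x z * Real.cosh (ρ x - ρ z) * u z := by
    rw [← Finset.sum_add_distrib, Finset.mul_sum]
    refine Finset.sum_congr rfl fun x _ => ?_
    rw [← Finset.sum_add_distrib, Finset.mul_sum]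
    refine Finset.sum_congr rfl fun z _ => ?_
    rw [Real.cosh_eq, show ρ z - ρ x = -(ρ x - ρ z) by ring]
    ring
  rw [← hswap] at h2
  linarith

/-- The conjugated form = the form + the `cosh`-DEFECT. [cite: Balaban1984PropagatorsI, p.36; Balaban1985BackgroundPropagators, (3.47) p.398] -/
theorem conjForm_eq_add_coshDefect {α : Type*} (S : Finset α) (K : α → α → ℝ) (hK : ∀ x ∈ S, ∀ z ∈ S, K x z = K z x) (ρ u : α → ℝ) :
    ∑ x ∈ S, ∑ z ∈ S, (Real.exp (ρ x) * u x) * K x z * (Real.exp (-ρ z) * u z)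
      = ∑ x ∈ S, ∑ z ∈ S, u x * K x z * u z + ∑ x ∈ S, ∑ z ∈ S, u x * K x z * (Real.cosh (ρ x - ρ z) - 1) * u z := by
  rw [conjForm_eq_cosh S K hK ρ u, ← Finset.sum_add_distrib]
  refine Finset.sum_congr rfl fun x _ => ?_
  rw [← Finset.sum_add_distrib]
  exact Finset.sum_congr rfl fun z _ => by ring

/-! ## §2 The weighted Schur test for the `cosh`-defect -/

/-- **WEIGHTED SCHUR TEST**: for `K` symmetric on `S`, any `ρ`, and a weight `ω` with the ROW condition
`Σ_{z∈S} |K(x,z)|·(cosh(ρ_x − ρ_z) − 1) ≤ θ·ω(x)` (`x ∈ S`), the defect obeys `|Σ u_xK(x,z)(cosh(ρ_x−ρ_z) − 1)u_z| ≤ θ·Σ_{x∈S} ω(x)u_x²`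
(`|u_xu_z| ≤ (u_x² + u_z²)∕2` and symmetry). [cite: Balaban1984PropagatorsI, p.36, (1.126) p.38 (row profile); Balaban1984PropagatorsII, Lemma 2.1 (2.61) p.234] -/
theorem coshDefect_le_of_rowBound {α : Type*} (S : Finset α) (K : α → α → ℝ) (hK : ∀ x ∈ S, ∀ z ∈ S, K x z = K z x) (ρ u : α → ℝ)
    (ω : α → ℝ) {θ : ℝ} (hrow : ∀ x ∈ S, ∑ z ∈ S, |K x z| * (Real.cosh (ρ x - ρ z) - 1) ≤ θ * ω x) :
    |∑ x ∈ S, ∑ z ∈ S, u x * K x z * (Real.cosh (ρ x - ρ z) - 1) * u z| ≤ θ * ∑ x ∈ S, ω x * u x ^ 2 := by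
  have hc0 : ∀ x z, 0 ≤ Real.cosh (ρ x - ρ z) - 1 := fun x z => sub_nonneg.mpr (Real.one_le_cosh _)
  -- pointwise: |u_x K c u_z| ≤ |K| c (u_x² + u_z²)/2
  have hpt : ∀ x z, |u x * K x z * (Real.cosh (ρ x - ρ z) - 1) * u z|
      ≤ |K x z| * (Real.cosh (ρ x - ρ z) - 1) * ((u x ^ 2 + u z ^ 2) / 2) := by
    intro x z
    rw [abs_mul, abs_mul, abs_mul, abs_of_nonneg (hc0 x z)]
    have h2 : |u x| * |u z| ≤ (u x ^ 2 + u z ^ 2) / 2 := by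
      have := two_mul_le_add_sq (|u x|) (|u z|)
      rw [sq_abs, sq_abs] at this
      linarith
    have hKc : 0 ≤ |K x z| * (Real.cosh (ρ x - ρ z) - 1) := mul_nonneg (abs_nonneg _) (hc0 x z)
    calc |u x| * |K x z| * (Real.cosh (ρ x - ρ z) - 1) * |u z| = |K x z| * (Real.cosh (ρ x - ρ z) - 1) * (|u x| * |u z|) := by ring
      _ ≤ |K x z| * (Real.cosh (ρ x - ρ z) - 1) * ((u x ^ 2 + u z ^ 2) / 2) := mul_le_mul_of_nonneg_left h2 hKc
  -- the symmetric split
  have hsym : ∑ x ∈ S, ∑ z ∈ S, |K x z| * (Real.cosh (ρ x - ρ z) - 1) * ((u x ^ 2 + u z ^ 2) / 2)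
      = ∑ x ∈ S, u x ^ 2 * ∑ z ∈ S, |K x z| * (Real.cosh (ρ x - ρ z) - 1) := by
    have hhalf : ∀ x z, |K x z| * (Real.cosh (ρ x - ρ z) - 1) * ((u x ^ 2 + u z ^ 2) / 2)
        = (|K x z| * (Real.cosh (ρ x - ρ z) - 1) * u x ^ 2) / 2 + (|K x z| * (Real.cosh (ρ x - ρ z) - 1) * u z ^ 2) / 2 := by
      intro x z; ring
    simp_rw [hhalf, Finset.sum_add_distrib]
    have hswap : ∑ x ∈ S, ∑ z ∈ S, (|K x z| * (Real.cosh (ρ x - ρ z) - 1) * u z ^ 2) / 2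
        = ∑ x ∈ S, ∑ z ∈ S, (|K x z| * (Real.cosh (ρ x - ρ z) - 1) * u x ^ 2) / 2 := by
      rw [Finset.sum_comm]
      refine Finset.sum_congr rfl fun x hx => Finset.sum_congr rfl fun z hz => ?_
      rw [hK z hz x hx, show ρ z - ρ x = -(ρ x - ρ z) by ring, Real.cosh_neg]
    rw [hswap, ← Finset.sum_add_distrib]
    refine Finset.sum_congr rfl fun x _ => ?_
    rw [← Finset.sum_add_distrib, Finset.mul_sum]
    exact Finset.sum_congr rfl fun z _ => by ring
  calc |∑ x ∈ S, ∑ z ∈ S, u x * K x z * (Real.cosh (ρ x - ρ z) - 1) * u z|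
      ≤ ∑ x ∈ S, |∑ z ∈ S, u x * K x z * (Real.cosh (ρ x - ρ z) - 1) * u z| := Finset.abs_sum_le_sum_abs _ _
    _ ≤ ∑ x ∈ S, ∑ z ∈ S, |u x * K x z * (Real.cosh (ρ x - ρ z) - 1) * u z| :=
        Finset.sum_le_sum fun x _ => Finset.abs_sum_le_sum_abs _ _
    _ ≤ ∑ x ∈ S, ∑ z ∈ S, |K x z| * (Real.cosh (ρ x - ρ z) - 1) * ((u x ^ 2 + u z ^ 2) / 2) :=
        Finset.sum_le_sum fun x _ => Finset.sum_le_sum fun z _ => hpt x z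
    _ = ∑ x ∈ S, u x ^ 2 * ∑ z ∈ S, |K x z| * (Real.cosh (ρ x - ρ z) - 1) := hsym
    _ ≤ ∑ x ∈ S, u x ^ 2 * (θ * ω x) := Finset.sum_le_sum fun x hx => mul_le_mul_of_nonneg_left (hrow x hx) (sq_nonneg _)
    _ = θ * ∑ x ∈ S, ω x * u x ^ 2 := by rw [Finset.mul_sum]; exact Finset.sum_congr rfl fun x _ => by ring

/-! ## §3 Conjugated coercivity and the weighted-`ℓ²` (Agmon) solve -/

/-- **CONJUGATED COERCIVITY**: a weighted lower bound `Σ ω u² ≤ ⟨u,Ku⟩` and the row condition with constant `θ` give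
`(1 − θ)·Σ_{x∈S} ω(x)u_x² ≤ ⟨e^{ρ}u, K e^{−ρ}u⟩`. [cite: Balaban1984PropagatorsI, p.36, (1.90) p.33; Balaban1985BackgroundPropagators, (3.47) p.398] -/
theorem conjForm_ge {α : Type*} (S : Finset α) (K : α → α → ℝ) (hK : ∀ x ∈ S, ∀ z ∈ S, K x z = K z x) (ρ u : α → ℝ)
    (ω : α → ℝ) {θ : ℝ} (hrow : ∀ x ∈ S, ∑ z ∈ S, |K x z| * (Real.cosh (ρ x - ρ z) - 1) ≤ θ * ω x)
    (hcoer : ∑ x ∈ S, ω x * u x ^ 2 ≤ ∑ x ∈ S, ∑ z ∈ S, u x * K x z * u z) :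
    (1 - θ) * ∑ x ∈ S, ω x * u x ^ 2 ≤ ∑ x ∈ S, ∑ z ∈ S, (Real.exp (ρ x) * u x) * K x z * (Real.exp (-ρ z) * u z) := by
  rw [conjForm_eq_add_coshDefect S K hK ρ u]
  have hdef := coshDefect_le_of_rowBound S K hK ρ u ω hrow
  have hlow := neg_abs_le (∑ x ∈ S, ∑ z ∈ S, u x * K x z * (Real.cosh (ρ x - ρ z) - 1) * u z)
  linarith

/-- **THE WEIGHTED-`ℓ²` DECAY ESTIMATE (Agmon ∕ Combes–Thomas solve)**: if `Kg = f` on `S`, the weight `ω` is positive on `S`, `θ < 1`, and the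
hypotheses of `conjForm_ge` hold for `u = e^{ρ}g`, then `(1 − θ)²·Σ_{x∈S} ω(x)e^{2ρ_x}g_x² ≤ Σ_{x∈S} ω(x)⁻¹e^{2ρ_x}f_x²`.
[cite: Balaban1984PropagatorsI, p.36, (1.114) p.36; Balaban1985BackgroundPropagators, (3.47) p.398] -/
theorem agmon_solve {α : Type*} (S : Finset α) (K : α → α → ℝ) (hK : ∀ x ∈ S, ∀ z ∈ S, K x z = K z x) (ρ : α → ℝ)
    (ω : α → ℝ) (hω : ∀ x ∈ S, 0 < ω x) {θ : ℝ} (hθ : θ < 1)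
    (hrow : ∀ x ∈ S, ∑ z ∈ S, |K x z| * (Real.cosh (ρ x - ρ z) - 1) ≤ θ * ω x)
    (g f : α → ℝ) (hKg : ∀ x ∈ S, ∑ z ∈ S, K x z * g z = f x)
    (hcoer : ∑ x ∈ S, ω x * (Real.exp (ρ x) * g x) ^ 2 ≤
      ∑ x ∈ S, ∑ z ∈ S, (Real.exp (ρ x) * g x) * K x z * (Real.exp (ρ z) * g z)) :
    (1 - θ) ^ 2 * ∑ x ∈ S, ω x * Real.exp (2 * ρ x) * g x ^ 2 ≤ ∑ x ∈ S, (ω x)⁻¹ * Real.exp (2 * ρ x) * f x ^ 2 := by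
  set u : α → ℝ := fun x => Real.exp (ρ x) * g x with hu
  -- `e^{−ρ}u = g`, so the conjugated form of `u` is `Σ e^{2ρ} g f`
  have hconj : ∑ x ∈ S, ∑ z ∈ S, (Real.exp (ρ x) * u x) * K x z * (Real.exp (-ρ z) * u z)
      = ∑ x ∈ S, Real.exp (2 * ρ x) * g x * f x := by
    refine Finset.sum_congr rfl fun x hx => ?_
    have hz : ∀ z, Real.exp (-ρ z) * u z = g z := fun z => by
      simp only [hu]; rw [← mul_assoc, ← Real.exp_add, neg_add_cancel, Real.exp_zero, one_mul]
    simp_rw [hz]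
    rw [← hKg x hx, Finset.mul_sum]
    refine Finset.sum_congr rfl fun z _ => ?_
    simp only [hu]
    rw [show (2 : ℝ) * ρ x = ρ x + ρ x by ring, Real.exp_add]
    ring
  have hge := conjForm_ge S K hK ρ u ω hrow (by simpa only [hu] using hcoer)
  rw [hconj] at hge
  -- A := Σ ω e^{2ρ} g², B := Σ ω⁻¹ e^{2ρ} f²; (1−θ)A ≤ Σ e^{2ρ} g f ≤ √A √B
  set A := ∑ x ∈ S, ω x * Real.exp (2 * ρ x) * g x ^ 2 with hA
  set B := ∑ x ∈ S, (ω x)⁻¹ * Real.exp (2 * ρ x) * f x ^ 2 with hB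
  have hAu : ∑ x ∈ S, ω x * u x ^ 2 = A := by
    refine Finset.sum_congr rfl fun x _ => ?_
    simp only [hu]
    rw [mul_pow, ← Real.exp_nat_mul]; push_cast; ring
  rw [hAu] at hge
  have hA0 : 0 ≤ A := Finset.sum_nonneg fun x hx => mul_nonneg (mul_nonneg (hω x hx).le (Real.exp_pos _).le) (sq_nonneg _)
  have hB0 : 0 ≤ B := Finset.sum_nonneg fun x hx => mul_nonneg (mul_nonneg (inv_nonneg.mpr (hω x hx).le) (Real.exp_pos _).le) (sq_nonneg _)
  -- Cauchy–Schwarz: (Σ e^{2ρ} g f)² ≤ A·B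
  have hCS : (∑ x ∈ S, Real.exp (2 * ρ x) * g x * f x) ^ 2 ≤ A * B := by
    have h := Finset.sum_mul_sq_le_sq_mul_sq S (fun x => Real.sqrt (ω x) * Real.exp (ρ x) * g x)
      (fun x => (Real.sqrt (ω x))⁻¹ * Real.exp (ρ x) * f x)
    have h1 : ∀ x ∈ S, Real.sqrt (ω x) * Real.exp (ρ x) * g x * ((Real.sqrt (ω x))⁻¹ * Real.exp (ρ x) * f x)
        = Real.exp (2 * ρ x) * g x * f x := by
      intro x hx
      have hs : Real.sqrt (ω x) ≠ 0 := (Real.sqrt_pos.mpr (hω x hx)).ne'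
      rw [show (2 : ℝ) * ρ x = ρ x + ρ x by ring, Real.exp_add]
      field_simp
    have h2 : ∀ x ∈ S, (Real.sqrt (ω x) * Real.exp (ρ x) * g x) ^ 2 = ω x * Real.exp (2 * ρ x) * g x ^ 2 := by
      intro x hx
      rw [mul_pow, mul_pow, Real.sq_sqrt (hω x hx).le, ← Real.exp_nat_mul]; push_cast; ring
    have h3 : ∀ x ∈ S, ((Real.sqrt (ω x))⁻¹ * Real.exp (ρ x) * f x) ^ 2 = (ω x)⁻¹ * Real.exp (2 * ρ x) * f x ^ 2 := by
      intro x hx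
      rw [mul_pow, mul_pow, inv_pow, Real.sq_sqrt (hω x hx).le, ← Real.exp_nat_mul]; push_cast; ring
    rw [Finset.sum_congr rfl h1, Finset.sum_congr rfl h2, Finset.sum_congr rfl h3] at h
    exact h
  -- conclude
  have h1θ : 0 < 1 - θ := by linarith
  by_cases hAz : A = 0
  · rw [hAz, mul_zero]; exact hB0
  · have hApos : 0 < A := lt_of_le_of_ne hA0 (Ne.symm hAz)
    have hs0 : 0 ≤ (1 - θ) * A := by positivity
    have hsq : (1 - θ) * A * ((1 - θ) * A) ≤
        (∑ x ∈ S, Real.exp (2 * ρ x) * g x * f x) * (∑ x ∈ S, Real.exp (2 * ρ x) * g x * f x) :=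
      mul_self_le_mul_self hs0 hge
    nlinarith [hsq, hCS, hApos, h1θ]

/-! ## §4 The multi-level instance: the row condition for the flat Dirichlet kernel under an Agmon-type weight -/

open Classical in
/-- Brick 1's lower bound rewritten with the SITE WEIGHT `ω(x) = Σ_j [Bʲ(x) ∈ Λ_j]·min{8,a′_j}·(Lʲη)⁻²`:
`Σ_{x∈S} ω(x)v(x)² = Σ_{j≤m} min{8,a′_j}(Lʲη)⁻² Σ_{x∈S : Bʲ(x)∈Λ_j} v(x)²`. [cite: Balaban1984PropagatorsII, (2.26)–(2.27) p.235; Balaban1985BackgroundPropagators, (3.24) p.394] -/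
theorem siteWeight_sum_eq {η : ℝ} (L m : ℕ) (Λs : ℕ → Set (Fin d → ℤ)) (a : ℕ → ℝ) (S : Finset (Fin d → ℤ)) (v : (Fin d → ℤ) → ℝ) :
    ∑ x ∈ S, (fun x => ∑ j ∈ Finset.range (m + 1), (if blockMap (L ^ j) x ∈ Λs j then min 8 (a j * η ^ 2 * ((L : ℝ) ^ j) ^ 2 * (((L : ℝ) ^ d) ^ j)⁻¹) * (((L : ℝ) ^ j * η) ^ 2)⁻¹ else 0)) x * v x ^ 2
      = ∑ j ∈ Finset.range (m + 1), min 8 (a j * η ^ 2 * ((L : ℝ) ^ j) ^ 2 * (((L : ℝ) ^ d) ^ j)⁻¹) * (((L : ℝ) ^ j * η) ^ 2)⁻¹ * ∑ x ∈ S.filter (fun x => blockMap (L ^ j) x ∈ Λs j), v x ^ 2 := by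
  simp only [Finset.sum_mul]
  rw [Finset.sum_comm]
  refine Finset.sum_congr rfl fun j _ => ?_
  rw [Finset.sum_filter, Finset.mul_sum]
  exact Finset.sum_congr rfl fun x _ => by split_ifs <;> ring

open Classical in
/-- **THE ROW CONDITION FOR THE FLAT DIRICHLET MULTI-LEVEL KERNEL**: if every site of `S` lies in a tower block lying in `S` (`hcover`, `hfull`), and `ρ`
varies across each bond at a tower site of level `j` by so little that `4d(cosh Δρ − 1) ≤ θ·min{8,a′_j}·L^{−2j}` (`hρ1`: «`|Δρ| ≲ δL^{−j}`») and oscillates on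
each tower block by so little that `2a′_j(cosh Δρ − 1) ≤ θ·min{8,a′_j}` (`hρ2`: «`osc ≲ δ`»), then
`Σ_{z∈S}|K(x,z)|(cosh(ρ_x − ρ_z) − 1) ≤ θ·ω(x)` for every `x ∈ S` — the hypothesis `hrow` of `coshDefect_le_of_rowBound` with brick 1's weight.
[cite: Balaban1984PropagatorsI, p.36 («for vectors q sufficiently small»), (1.126) p.38; Balaban1984PropagatorsII, (2.46) p.231 (the block distance); Balaban1985BackgroundPropagators, (3.47) p.398] -/
theorem rowBound_flatDirichlet {η : ℝ} (hη : η ≠ 0) {L : ℕ} (hL : 1 ≤ L) (m : ℕ) (Λs : ℕ → Set (Fin d → ℤ)) (a : ℕ → ℝ) (ha : ∀ j, 0 ≤ a j)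
    (K : (Fin d → ℤ) → (Fin d → ℤ) → ℝ)
    (hK : ∀ x z, K x z = ((η ^ 2)⁻¹ * ∑ μ : Fin d, ((2 : ℝ) * (if z = x then (1 : ℝ) else 0) - (if z = x + e μ then (1 : ℝ) else 0)
        - (if z = x - e μ then (1 : ℝ) else 0))) +
        (∑ j ∈ Finset.range (m + 1), (if blockMap (L ^ j) x ∈ Λs j ∧ blockMap (L ^ j) z = blockMap (L ^ j) x then
          a j * ((((L : ℝ) ^ d)⁻¹) ^ j) ^ 2 else 0)))
    (S : Finset (Fin d → ℤ))
    (hfull : ∀ j, j ≤ m → ∀ x ∈ S, blockMap (L ^ j) x ∈ Λs j → ∀ z, blockMap (L ^ j) z = blockMap (L ^ j) x → z ∈ S)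
    (hcover : ∀ x ∈ S, ∃ j, j ≤ m ∧ blockMap (L ^ j) x ∈ Λs j)
    (ρ : (Fin d → ℤ) → ℝ) {θ : ℝ} (hθ : 0 ≤ θ)
    (hρ1 : ∀ x ∈ S, ∀ j, j ≤ m → blockMap (L ^ j) x ∈ Λs j → ∀ μ : Fin d,
      (x + e μ ∈ S → 4 * (d : ℝ) * (Real.cosh (ρ x - ρ (x + e μ)) - 1) ≤ θ * min 8 (a j * η ^ 2 * ((L : ℝ) ^ j) ^ 2 * (((L : ℝ) ^ d) ^ j)⁻¹) * (((L : ℝ) ^ j) ^ 2)⁻¹) ∧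
      (x - e μ ∈ S → 4 * (d : ℝ) * (Real.cosh (ρ x - ρ (x - e μ)) - 1) ≤ θ * min 8 (a j * η ^ 2 * ((L : ℝ) ^ j) ^ 2 * (((L : ℝ) ^ d) ^ j)⁻¹) * (((L : ℝ) ^ j) ^ 2)⁻¹))
    (hρ2 : ∀ x ∈ S, ∀ j, j ≤ m → blockMap (L ^ j) x ∈ Λs j → ∀ z ∈ S, blockMap (L ^ j) z = blockMap (L ^ j) x →
      2 * (a j * η ^ 2 * ((L : ℝ) ^ j) ^ 2 * (((L : ℝ) ^ d) ^ j)⁻¹) * (Real.cosh (ρ x - ρ z) - 1) ≤ θ * min 8 (a j * η ^ 2 * ((L : ℝ) ^ j) ^ 2 * (((L : ℝ) ^ d) ^ j)⁻¹))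
    (x : Fin d → ℤ) (hx : x ∈ S) :
    ∑ z ∈ S, |K x z| * (Real.cosh (ρ x - ρ z) - 1) ≤ θ * (fun x => ∑ j ∈ Finset.range (m + 1), (if blockMap (L ^ j) x ∈ Λs j then min 8 (a j * η ^ 2 * ((L : ℝ) ^ j) ^ 2 * (((L : ℝ) ^ d) ^ j)⁻¹) * (((L : ℝ) ^ j * η) ^ 2)⁻¹ else 0)) x := by
  have hc0 : ∀ z, 0 ≤ Real.cosh (ρ x - ρ z) - 1 := fun z => sub_nonneg.mpr (Real.one_le_cosh _)
  have hL0 : (0 : ℝ) < L := by exact_mod_cast hL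
  -- weights are non-negative
  have hW : ∀ j, 0 ≤ min 8 (a j * η ^ 2 * ((L : ℝ) ^ j) ^ 2 * (((L : ℝ) ^ d) ^ j)⁻¹) * (((L : ℝ) ^ j * η) ^ 2)⁻¹ := fun j =>
    mul_nonneg (le_min (by norm_num) (by have := ha j; positivity)) (by positivity)
  -- pointwise bound on `|K x z|·c(x,z)`: the diagonal is killed by `c(x,x) = 0`
  have hKabs : ∀ z, |K x z| * (Real.cosh (ρ x - ρ z) - 1) ≤
      ((η ^ 2)⁻¹ * ∑ μ : Fin d, ((if z = x + e μ then (1 : ℝ) else 0) + (if z = x - e μ then (1 : ℝ) else 0))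
        + ∑ j ∈ Finset.range (m + 1), (if blockMap (L ^ j) x ∈ Λs j ∧ blockMap (L ^ j) z = blockMap (L ^ j) x then
          a j * ((((L : ℝ) ^ d)⁻¹) ^ j) ^ 2 else 0)) * (Real.cosh (ρ x - ρ z) - 1) := by
    intro z
    by_cases hzx : z = x
    · rw [hzx, sub_self, Real.cosh_zero, sub_self, mul_zero, mul_zero]
    refine mul_le_mul_of_nonneg_right ?_ (hc0 z)
    rw [hK]
    refine (abs_add_le _ _).trans (add_le_add ?_ ?_)
    · rw [abs_mul, abs_of_nonneg (by positivity : (0 : ℝ) ≤ (η ^ 2)⁻¹)]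
      refine mul_le_mul_of_nonneg_left ((Finset.abs_sum_le_sum_abs _ _).trans (Finset.sum_le_sum fun μ _ => ?_)) (by positivity)
      rw [if_neg hzx]
      split_ifs <;> norm_num
    · refine (Finset.abs_sum_le_sum_abs _ _).trans (Finset.sum_le_sum fun j _ => ?_)
      split_ifs with h
      · exact le_of_eq (abs_of_nonneg (by have := ha j; positivity))
      · simp
  -- sum over `z ∈ S`: nearest-neighbour part and block part
  have hnn : ∀ μ : Fin d, ∑ z ∈ S, ((if z = x + e μ then (1 : ℝ) else 0) + (if z = x - e μ then (1 : ℝ) else 0)) * (Real.cosh (ρ x - ρ z) - 1)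
      = (if x + e μ ∈ S then Real.cosh (ρ x - ρ (x + e μ)) - 1 else 0) + (if x - e μ ∈ S then Real.cosh (ρ x - ρ (x - e μ)) - 1 else 0) := by
    intro μ
    simp only [add_mul, Finset.sum_add_distrib, ite_mul, one_mul, zero_mul, Finset.sum_ite_eq' S]
  have hblk : ∀ j ∈ Finset.range (m + 1), ∑ z ∈ S, (if blockMap (L ^ j) x ∈ Λs j ∧ blockMap (L ^ j) z = blockMap (L ^ j) x then
        a j * ((((L : ℝ) ^ d)⁻¹) ^ j) ^ 2 else 0) * (Real.cosh (ρ x - ρ z) - 1)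
      ≤ if blockMap (L ^ j) x ∈ Λs j then θ / 2 * (min 8 (a j * η ^ 2 * ((L : ℝ) ^ j) ^ 2 * (((L : ℝ) ^ d) ^ j)⁻¹) * (((L : ℝ) ^ j * η) ^ 2)⁻¹) else 0 := by
    intro j hj
    have hjm : j ≤ m := Nat.lt_succ_iff.mp (Finset.mem_range.mp hj)
    by_cases hxj : blockMap (L ^ j) x ∈ Λs j
    · rw [if_pos hxj]
      -- the block `S.filter (bm_j · = bm_j x)` is a genuine block of side `L^j`
      obtain ⟨n, hn⟩ : ∃ n, L ^ j = n + 1 := Nat.exists_eq_succ_of_ne_zero (pow_ne_zero j (by omega))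
      have hB : ∀ z, z ∈ S.filter (fun z => blockMap (L ^ j) z = blockMap (L ^ j) x) ↔ blockMap (n + 1) z = blockMap (L ^ j) x := by
        intro z
        rw [Finset.mem_filter, ← hn]
        exact ⟨fun h => h.2, fun h => ⟨hfull j hjm x hx hxj z h, h⟩⟩
      have hcard : ∑ z ∈ S.filter (fun z => blockMap (L ^ j) z = blockMap (L ^ j) x), (1 : ℝ) = ((L : ℝ) ^ d) ^ j := by
        rw [sum_block_eq n (blockMap (L ^ j) x) _ hB (fun _ => (1 : ℝ)), Finset.sum_const, Finset.card_univ, Fintype.card_fun,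
          Fintype.card_fin, Fintype.card_fin, nsmul_eq_mul, mul_one]
        rw [← pow_mul, mul_comm, pow_mul]
        exact_mod_cast congrArg (fun t => t ^ d) hn.symm
      -- each term of the block ≤ the oscillation bound
      have hsum : ∑ z ∈ S, (if blockMap (L ^ j) x ∈ Λs j ∧ blockMap (L ^ j) z = blockMap (L ^ j) x then
            a j * ((((L : ℝ) ^ d)⁻¹) ^ j) ^ 2 else 0) * (Real.cosh (ρ x - ρ z) - 1)
          = ∑ z ∈ S.filter (fun z => blockMap (L ^ j) z = blockMap (L ^ j) x),
              a j * ((((L : ℝ) ^ d)⁻¹) ^ j) ^ 2 * (Real.cosh (ρ x - ρ z) - 1) := by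
        rw [Finset.sum_filter]
        refine Finset.sum_congr rfl fun z _ => ?_
        by_cases hz : blockMap (L ^ j) z = blockMap (L ^ j) x
        · rw [if_pos ⟨hxj, hz⟩, if_pos hz]
        · rw [if_neg (fun h => hz h.2), if_neg hz, zero_mul]
      rw [hsum]
      have hpt : ∀ z ∈ S.filter (fun z => blockMap (L ^ j) z = blockMap (L ^ j) x),
          a j * ((((L : ℝ) ^ d)⁻¹) ^ j) ^ 2 * (Real.cosh (ρ x - ρ z) - 1)
            ≤ (((L : ℝ) ^ d) ^ j)⁻¹ * (θ / 2 * (min 8 (a j * η ^ 2 * ((L : ℝ) ^ j) ^ 2 * (((L : ℝ) ^ d) ^ j)⁻¹) * (((L : ℝ) ^ j * η) ^ 2)⁻¹)) * 1 := by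
        intro z hz
        obtain ⟨hzS, hzb⟩ := Finset.mem_filter.mp hz
        have h2 := hρ2 x hx j hjm hxj z hzS hzb
        have hLj : (L : ℝ) ^ j ≠ 0 := pow_ne_zero j hL0.ne'
        have hLdj : ((L : ℝ) ^ d) ^ j ≠ 0 := pow_ne_zero j (pow_ne_zero d hL0.ne')
        have hid : a j * ((((L : ℝ) ^ d)⁻¹) ^ j) ^ 2 * (Real.cosh (ρ x - ρ z) - 1)
            = (((L : ℝ) ^ d) ^ j)⁻¹ * (((L : ℝ) ^ j * η) ^ 2)⁻¹ * ((a j * η ^ 2 * ((L : ℝ) ^ j) ^ 2 * (((L : ℝ) ^ d) ^ j)⁻¹) * (Real.cosh (ρ x - ρ z) - 1)) := by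
          rw [inv_pow]; field_simp
        rw [hid, mul_one]
        have hW0 : 0 ≤ (((L : ℝ) ^ d) ^ j)⁻¹ * (((L : ℝ) ^ j * η) ^ 2)⁻¹ := by positivity
        calc (((L : ℝ) ^ d) ^ j)⁻¹ * (((L : ℝ) ^ j * η) ^ 2)⁻¹ * ((a j * η ^ 2 * ((L : ℝ) ^ j) ^ 2 * (((L : ℝ) ^ d) ^ j)⁻¹) * (Real.cosh (ρ x - ρ z) - 1))
            ≤ (((L : ℝ) ^ d) ^ j)⁻¹ * (((L : ℝ) ^ j * η) ^ 2)⁻¹ * (θ / 2 * min 8 (a j * η ^ 2 * ((L : ℝ) ^ j) ^ 2 * (((L : ℝ) ^ d) ^ j)⁻¹)) := mul_le_mul_of_nonneg_left (by linarith) hW0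
          _ = (((L : ℝ) ^ d) ^ j)⁻¹ * (θ / 2 * (min 8 (a j * η ^ 2 * ((L : ℝ) ^ j) ^ 2 * (((L : ℝ) ^ d) ^ j)⁻¹) * (((L : ℝ) ^ j * η) ^ 2)⁻¹)) := by ring
      refine (Finset.sum_le_sum hpt).trans ?_
      rw [← Finset.mul_sum, hcard]
      have hLdj : ((L : ℝ) ^ d) ^ j ≠ 0 := pow_ne_zero j (pow_ne_zero d hL0.ne')
      rw [mul_comm, ← mul_assoc, mul_inv_cancel₀ hLdj, one_mul]
    · rw [if_neg hxj]
      refine le_of_eq (Finset.sum_eq_zero fun z _ => ?_)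
      rw [if_neg (fun h => hxj h.1), zero_mul]
  -- the nearest-neighbour part: one tower level `j₀` of `x` (cover) pays for all `2d` bonds
  obtain ⟨j₀, hj₀m, hxj₀⟩ := hcover x hx
  have hnn_le : (η ^ 2)⁻¹ * ∑ μ : Fin d, ((if x + e μ ∈ S then Real.cosh (ρ x - ρ (x + e μ)) - 1 else 0)
        + (if x - e μ ∈ S then Real.cosh (ρ x - ρ (x - e μ)) - 1 else 0))
      ≤ θ / 2 * (min 8 (a j₀ * η ^ 2 * ((L : ℝ) ^ j₀) ^ 2 * (((L : ℝ) ^ d) ^ j₀)⁻¹) * (((L : ℝ) ^ j₀ * η) ^ 2)⁻¹) := by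
    by_cases hd : d = 0
    · subst hd
      rw [Finset.univ_eq_empty, Finset.sum_empty, mul_zero]
      exact mul_nonneg (by linarith) (hW j₀)
    have hdpos : (0 : ℝ) < d := by exact_mod_cast Nat.pos_of_ne_zero hd
    have hb : ∀ μ : Fin d, (if x + e μ ∈ S then Real.cosh (ρ x - ρ (x + e μ)) - 1 else 0)
        + (if x - e μ ∈ S then Real.cosh (ρ x - ρ (x - e μ)) - 1 else 0)
        ≤ 2 * (θ * min 8 (a j₀ * η ^ 2 * ((L : ℝ) ^ j₀) ^ 2 * (((L : ℝ) ^ d) ^ j₀)⁻¹) * (((L : ℝ) ^ j₀) ^ 2)⁻¹ / (4 * d)) := by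
      intro μ
      obtain ⟨h1, h2⟩ := hρ1 x hx j₀ hj₀m hxj₀ μ
      have hq : 0 ≤ θ * min 8 (a j₀ * η ^ 2 * ((L : ℝ) ^ j₀) ^ 2 * (((L : ℝ) ^ d) ^ j₀)⁻¹) * (((L : ℝ) ^ j₀) ^ 2)⁻¹ / (4 * d) :=
        div_nonneg (mul_nonneg (mul_nonneg hθ (le_min (by norm_num) (by have := ha j₀; positivity))) (by positivity)) (by positivity)
      have hp : (if x + e μ ∈ S then Real.cosh (ρ x - ρ (x + e μ)) - 1 else 0)
          ≤ θ * min 8 (a j₀ * η ^ 2 * ((L : ℝ) ^ j₀) ^ 2 * (((L : ℝ) ^ d) ^ j₀)⁻¹) * (((L : ℝ) ^ j₀) ^ 2)⁻¹ / (4 * d) := by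
        split_ifs with hs
        · rw [le_div_iff₀ (by positivity)]; linarith [h1 hs]
        · exact hq
      have hm : (if x - e μ ∈ S then Real.cosh (ρ x - ρ (x - e μ)) - 1 else 0)
          ≤ θ * min 8 (a j₀ * η ^ 2 * ((L : ℝ) ^ j₀) ^ 2 * (((L : ℝ) ^ d) ^ j₀)⁻¹) * (((L : ℝ) ^ j₀) ^ 2)⁻¹ / (4 * d) := by
        split_ifs with hs
        · rw [le_div_iff₀ (by positivity)]; linarith [h2 hs]
        · exact hq
      linarith
    have hsum := Finset.sum_le_sum fun μ (_ : μ ∈ (Finset.univ : Finset (Fin d))) => hb μ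
    rw [Finset.sum_const, Finset.card_univ, Fintype.card_fin, nsmul_eq_mul] at hsum
    have hLj : (L : ℝ) ^ j₀ ≠ 0 := pow_ne_zero j₀ hL0.ne'
    have hid : (η ^ 2)⁻¹ * ((d : ℝ) * (2 * (θ * min 8 (a j₀ * η ^ 2 * ((L : ℝ) ^ j₀) ^ 2 * (((L : ℝ) ^ d) ^ j₀)⁻¹) * (((L : ℝ) ^ j₀) ^ 2)⁻¹ / (4 * d))))
        = θ / 2 * (min 8 (a j₀ * η ^ 2 * ((L : ℝ) ^ j₀) ^ 2 * (((L : ℝ) ^ d) ^ j₀)⁻¹) * (((L : ℝ) ^ j₀ * η) ^ 2)⁻¹) := by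
      field_simp
      ring
    calc (η ^ 2)⁻¹ * ∑ μ : Fin d, ((if x + e μ ∈ S then Real.cosh (ρ x - ρ (x + e μ)) - 1 else 0)
          + (if x - e μ ∈ S then Real.cosh (ρ x - ρ (x - e μ)) - 1 else 0))
        ≤ (η ^ 2)⁻¹ * ((d : ℝ) * (2 * (θ * min 8 (a j₀ * η ^ 2 * ((L : ℝ) ^ j₀) ^ 2 * (((L : ℝ) ^ d) ^ j₀)⁻¹) * (((L : ℝ) ^ j₀) ^ 2)⁻¹ / (4 * d)))) :=
          mul_le_mul_of_nonneg_left hsum (by positivity)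
      _ = _ := hid
  -- the `j₀`-term is one of the non-negative terms of `ω(x)`
  have hω_ge : min 8 (a j₀ * η ^ 2 * ((L : ℝ) ^ j₀) ^ 2 * (((L : ℝ) ^ d) ^ j₀)⁻¹) * (((L : ℝ) ^ j₀ * η) ^ 2)⁻¹ ≤ (fun x => ∑ j ∈ Finset.range (m + 1), (if blockMap (L ^ j) x ∈ Λs j then min 8 (a j * η ^ 2 * ((L : ℝ) ^ j) ^ 2 * (((L : ℝ) ^ d) ^ j)⁻¹) * (((L : ℝ) ^ j * η) ^ 2)⁻¹ else 0)) x := by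
    have hmem : j₀ ∈ Finset.range (m + 1) := Finset.mem_range.mpr (Nat.lt_succ_of_le hj₀m)
    refine le_trans ?_ (Finset.single_le_sum (f := fun j => (if blockMap (L ^ j) x ∈ Λs j then min 8 (a j * η ^ 2 * ((L : ℝ) ^ j) ^ 2 * (((L : ℝ) ^ d) ^ j)⁻¹) * (((L : ℝ) ^ j * η) ^ 2)⁻¹ else 0))
      (fun j _ => by split_ifs; exacts [hW j, le_rfl]) hmem)
    simp only [if_pos hxj₀, le_refl]
  have hblk_sum : ∑ j ∈ Finset.range (m + 1), ∑ z ∈ S, (if blockMap (L ^ j) x ∈ Λs j ∧ blockMap (L ^ j) z = blockMap (L ^ j) x then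
        a j * ((((L : ℝ) ^ d)⁻¹) ^ j) ^ 2 else 0) * (Real.cosh (ρ x - ρ z) - 1) ≤ θ / 2 * (fun x => ∑ j ∈ Finset.range (m + 1), (if blockMap (L ^ j) x ∈ Λs j then min 8 (a j * η ^ 2 * ((L : ℝ) ^ j) ^ 2 * (((L : ℝ) ^ d) ^ j)⁻¹) * (((L : ℝ) ^ j * η) ^ 2)⁻¹ else 0)) x := by
    refine (Finset.sum_le_sum hblk).trans (le_of_eq ?_)
    rw [Finset.mul_sum]
    exact Finset.sum_congr rfl fun j _ => by split_ifs <;> ring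
  -- assemble
  calc ∑ z ∈ S, |K x z| * (Real.cosh (ρ x - ρ z) - 1)
      ≤ ∑ z ∈ S, ((η ^ 2)⁻¹ * ∑ μ : Fin d, ((if z = x + e μ then (1 : ℝ) else 0) + (if z = x - e μ then (1 : ℝ) else 0))
          + ∑ j ∈ Finset.range (m + 1), (if blockMap (L ^ j) x ∈ Λs j ∧ blockMap (L ^ j) z = blockMap (L ^ j) x then
            a j * ((((L : ℝ) ^ d)⁻¹) ^ j) ^ 2 else 0)) * (Real.cosh (ρ x - ρ z) - 1) := Finset.sum_le_sum fun z _ => hKabs z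
    _ = (η ^ 2)⁻¹ * ∑ μ : Fin d, ((if x + e μ ∈ S then Real.cosh (ρ x - ρ (x + e μ)) - 1 else 0)
          + (if x - e μ ∈ S then Real.cosh (ρ x - ρ (x - e μ)) - 1 else 0))
        + ∑ j ∈ Finset.range (m + 1), ∑ z ∈ S, (if blockMap (L ^ j) x ∈ Λs j ∧ blockMap (L ^ j) z = blockMap (L ^ j) x then
            a j * ((((L : ℝ) ^ d)⁻¹) ^ j) ^ 2 else 0) * (Real.cosh (ρ x - ρ z) - 1) := by
        rw [Finset.sum_congr rfl fun z _ => add_mul _ _ _, Finset.sum_add_distrib]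
        congr 1
        · calc ∑ z ∈ S, ((η ^ 2)⁻¹ * ∑ μ : Fin d, ((if z = x + e μ then (1 : ℝ) else 0) + (if z = x - e μ then (1 : ℝ) else 0)))
                  * (Real.cosh (ρ x - ρ z) - 1)
              = (η ^ 2)⁻¹ * ∑ z ∈ S, ∑ μ : Fin d, ((if z = x + e μ then (1 : ℝ) else 0) + (if z = x - e μ then (1 : ℝ) else 0))
                  * (Real.cosh (ρ x - ρ z) - 1) := by
                rw [Finset.mul_sum]
                refine Finset.sum_congr rfl fun z _ => ?_
                rw [mul_assoc, Finset.sum_mul]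
            _ = (η ^ 2)⁻¹ * ∑ μ : Fin d, ∑ z ∈ S, ((if z = x + e μ then (1 : ℝ) else 0) + (if z = x - e μ then (1 : ℝ) else 0))
                  * (Real.cosh (ρ x - ρ z) - 1) := by rw [Finset.sum_comm]
            _ = _ := by
                congr 1
                exact Finset.sum_congr rfl fun μ _ => hnn μ
        · rw [Finset.sum_comm]
          exact Finset.sum_congr rfl fun z _ => by rw [Finset.sum_mul]
    _ ≤ θ / 2 * (fun x => ∑ j ∈ Finset.range (m + 1), (if blockMap (L ^ j) x ∈ Λs j then min 8 (a j * η ^ 2 * ((L : ℝ) ^ j) ^ 2 * (((L : ℝ) ^ d) ^ j)⁻¹) * (((L : ℝ) ^ j * η) ^ 2)⁻¹ else 0)) x + θ / 2 * (fun x => ∑ j ∈ Finset.range (m + 1), (if blockMap (L ^ j) x ∈ Λs j then min 8 (a j * η ^ 2 * ((L : ℝ) ^ j) ^ 2 * (((L : ℝ) ^ d) ^ j)⁻¹) * (((L : ℝ) ^ j * η) ^ 2)⁻¹ else 0)) x := add_le_add (hnn_le.trans (mul_le_mul_of_nonneg_left hω_ge (by linarith))) hblk_sum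
    _ = θ * (fun x => ∑ j ∈ Finset.range (m + 1), (if blockMap (L ^ j) x ∈ Λs j then min 8 (a j * η ^ 2 * ((L : ℝ) ^ j) ^ 2 * (((L : ℝ) ^ d) ^ j)⁻¹) * (((L : ℝ) ^ j * η) ^ 2)⁻¹ else 0)) x := by ring

/-! ## §5 Conjugated coercivity and the Agmon solve for the flat Dirichlet multi-level kernel; the cube member -/

open Classical in
/-- **CONJUGATED COERCIVITY OF THE FLAT DIRICHLET MULTI-LEVEL FORM** (brick 1 + the row condition): under the tower geometry of
`B8Eq191FlatDirichletCoercive.weighted_coercive_flatDirichlet` (`hfull`, `hdisj`) with every site of `S` in a tower block (`hcover`), and an exponent `ρ` obeying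
`hρ1`∕`hρ2` with constant `θ ≥ 0`: for `u` supported in `S`,
`(1 − θ)·Σ_{x∈S} ω(x)u(x)² ≤ Σ_{x,z∈S} (e^{ρ_x}u_x)K(x,z)(e^{−ρ_z}u_z)`, `ω(x) = Σ_j[Bʲ(x)∈Λ_j]min{8,a′_j}(Lʲη)⁻²`.
[cite: Balaban1984PropagatorsI, p.36, (1.90) p.33; Balaban1984PropagatorsII, (2.26)–(2.27) p.235, p.228; Balaban1985BackgroundPropagators, (3.47) p.398; Balaban1985RegularSpaces, (1.91) p.91] -/
theorem conj_coercive_flatDirichlet {η : ℝ} (hη : η ≠ 0) {L : ℕ} (hL : 1 ≤ L) (m : ℕ) (Λs : ℕ → Set (Fin d → ℤ)) (a : ℕ → ℝ) (ha : ∀ j, 0 ≤ a j)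
    (K : (Fin d → ℤ) → (Fin d → ℤ) → ℝ)
    (hK : ∀ x z, K x z = ((η ^ 2)⁻¹ * ∑ μ : Fin d, ((2 : ℝ) * (if z = x then (1 : ℝ) else 0) - (if z = x + e μ then (1 : ℝ) else 0)
        - (if z = x - e μ then (1 : ℝ) else 0))) +
        (∑ j ∈ Finset.range (m + 1), (if blockMap (L ^ j) x ∈ Λs j ∧ blockMap (L ^ j) z = blockMap (L ^ j) x then
          a j * ((((L : ℝ) ^ d)⁻¹) ^ j) ^ 2 else 0)))
    (S : Finset (Fin d → ℤ)) (u : (Fin d → ℤ) → ℝ) (hu : ∀ w, w ∉ S → u w = 0)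
    (hfull : ∀ j, j ≤ m → ∀ x ∈ S, blockMap (L ^ j) x ∈ Λs j → ∀ z, blockMap (L ^ j) z = blockMap (L ^ j) x → z ∈ S)
    (hdisj : ∀ x ∈ S, ∀ j, j ≤ m → ∀ j', j' ≤ m → blockMap (L ^ j) x ∈ Λs j → blockMap (L ^ j') x ∈ Λs j' → j = j')
    (hcover : ∀ x ∈ S, ∃ j, j ≤ m ∧ blockMap (L ^ j) x ∈ Λs j)
    (ρ : (Fin d → ℤ) → ℝ) {θ : ℝ} (hθ : 0 ≤ θ)
    (hρ1 : ∀ x ∈ S, ∀ j, j ≤ m → blockMap (L ^ j) x ∈ Λs j → ∀ μ : Fin d,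
      (x + e μ ∈ S → 4 * (d : ℝ) * (Real.cosh (ρ x - ρ (x + e μ)) - 1) ≤ θ * min 8 (a j * η ^ 2 * ((L : ℝ) ^ j) ^ 2 * (((L : ℝ) ^ d) ^ j)⁻¹) * (((L : ℝ) ^ j) ^ 2)⁻¹) ∧
      (x - e μ ∈ S → 4 * (d : ℝ) * (Real.cosh (ρ x - ρ (x - e μ)) - 1) ≤ θ * min 8 (a j * η ^ 2 * ((L : ℝ) ^ j) ^ 2 * (((L : ℝ) ^ d) ^ j)⁻¹) * (((L : ℝ) ^ j) ^ 2)⁻¹))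
    (hρ2 : ∀ x ∈ S, ∀ j, j ≤ m → blockMap (L ^ j) x ∈ Λs j → ∀ z ∈ S, blockMap (L ^ j) z = blockMap (L ^ j) x →
      2 * (a j * η ^ 2 * ((L : ℝ) ^ j) ^ 2 * (((L : ℝ) ^ d) ^ j)⁻¹) * (Real.cosh (ρ x - ρ z) - 1) ≤ θ * min 8 (a j * η ^ 2 * ((L : ℝ) ^ j) ^ 2 * (((L : ℝ) ^ d) ^ j)⁻¹)) :
    (1 - θ) * ∑ x ∈ S, (fun x => ∑ j ∈ Finset.range (m + 1), (if blockMap (L ^ j) x ∈ Λs j then min 8 (a j * η ^ 2 * ((L : ℝ) ^ j) ^ 2 * (((L : ℝ) ^ d) ^ j)⁻¹) * (((L : ℝ) ^ j * η) ^ 2)⁻¹ else 0)) x * u x ^ 2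
      ≤ ∑ x ∈ S, ∑ z ∈ S, (Real.exp (ρ x) * u x) * K x z * (Real.exp (-ρ z) * u z) := by
  refine conjForm_ge S K (fun x _ z _ => flatKernel_symm L m Λs a K hK x z) ρ u _
    (fun x hx => rowBound_flatDirichlet hη hL m Λs a ha K hK S hfull hcover ρ hθ hρ1 hρ2 x hx) ?_
  rw [siteWeight_sum_eq L m Λs a S u]
  exact weighted_coercive_flatDirichlet hη hL m Λs a K hK S u hu hfull hdisj

open Classical in
/-- The site weight is POSITIVE on `S` when the level weights are (`a_j > 0`) and every site lies in a tower block. [cite: Balaban1984PropagatorsII, (2.26)–(2.27) p.235] -/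
theorem siteWeight_pos {η : ℝ} (hη : η ≠ 0) {L : ℕ} (hL : 1 ≤ L) (m : ℕ) (Λs : ℕ → Set (Fin d → ℤ)) (a : ℕ → ℝ) (ha : ∀ j, 0 < a j)
    (S : Finset (Fin d → ℤ)) (hcover : ∀ x ∈ S, ∃ j, j ≤ m ∧ blockMap (L ^ j) x ∈ Λs j) (x : Fin d → ℤ) (hx : x ∈ S) :
    0 < (fun x => ∑ j ∈ Finset.range (m + 1), (if blockMap (L ^ j) x ∈ Λs j then min 8 (a j * η ^ 2 * ((L : ℝ) ^ j) ^ 2 * (((L : ℝ) ^ d) ^ j)⁻¹) * (((L : ℝ) ^ j * η) ^ 2)⁻¹ else 0)) x := by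
  have hL0 : (0 : ℝ) < L := by exact_mod_cast hL
  obtain ⟨j₀, hj₀m, hxj₀⟩ := hcover x hx
  have hpos : 0 < min 8 (a j₀ * η ^ 2 * ((L : ℝ) ^ j₀) ^ 2 * (((L : ℝ) ^ d) ^ j₀)⁻¹) * (((L : ℝ) ^ j₀ * η) ^ 2)⁻¹ :=
    mul_pos (lt_min (by norm_num) (by have := ha j₀; positivity)) (by positivity)
  have hW : ∀ j, 0 ≤ min 8 (a j * η ^ 2 * ((L : ℝ) ^ j) ^ 2 * (((L : ℝ) ^ d) ^ j)⁻¹) * (((L : ℝ) ^ j * η) ^ 2)⁻¹ := fun j =>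
    mul_nonneg (le_min (by norm_num) (by have := (ha j).le; positivity)) (by positivity)
  refine lt_of_lt_of_le hpos ?_
  refine le_trans ?_ (Finset.single_le_sum (f := fun j => (if blockMap (L ^ j) x ∈ Λs j then min 8 (a j * η ^ 2 * ((L : ℝ) ^ j) ^ 2 * (((L : ℝ) ^ d) ^ j)⁻¹) * (((L : ℝ) ^ j * η) ^ 2)⁻¹ else 0))
    (fun j _ => by split_ifs; exacts [hW j, le_rfl]) (Finset.mem_range.mpr (Nat.lt_succ_of_le hj₀m)))
  simp only [if_pos hxj₀, le_refl]

open Classical in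
/-- **THE WEIGHTED-`ℓ²` DECAY ESTIMATE FOR THE FLAT DIRICHLET MULTI-LEVEL GREEN'S FUNCTION** ([B5] p. 36 ∕ [4] (3.47)-type, at `U₀ = 1`, Dirichlet):
if `Kg = f` on `S` (`g` supported in `S` — e.g. `g = T⁻¹f` for the matrix of `B8Eq191FlatDirichletForm.isUnit_flatMatrix`), the tower geometry holds, every
site is covered, `a_j > 0`, `0 ≤ θ < 1`, and the exponent `ρ` obeys `hρ1`∕`hρ2`, then
`(1 − θ)²·Σ_{x∈S} ω(x)e^{2ρ_x}g(x)² ≤ Σ_{x∈S} ω(x)⁻¹e^{2ρ_x}f(x)²` — the decay of `T⁻¹` in the weights `e^{ρ}`, uniform in the number of levels.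
[cite: Balaban1984PropagatorsI, p.36, (1.114) p.36; Balaban1985BackgroundPropagators, Thm 3.1 (3.47) p.398; Balaban1985RegularSpaces, (1.101) p.93; Balaban1984PropagatorsII, p.228] -/
theorem agmon_solve_flatDirichlet {η : ℝ} (hη : η ≠ 0) {L : ℕ} (hL : 1 ≤ L) (m : ℕ) (Λs : ℕ → Set (Fin d → ℤ)) (a : ℕ → ℝ) (ha : ∀ j, 0 < a j)
    (K : (Fin d → ℤ) → (Fin d → ℤ) → ℝ)
    (hK : ∀ x z, K x z = ((η ^ 2)⁻¹ * ∑ μ : Fin d, ((2 : ℝ) * (if z = x then (1 : ℝ) else 0) - (if z = x + e μ then (1 : ℝ) else 0)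
        - (if z = x - e μ then (1 : ℝ) else 0))) +
        (∑ j ∈ Finset.range (m + 1), (if blockMap (L ^ j) x ∈ Λs j ∧ blockMap (L ^ j) z = blockMap (L ^ j) x then
          a j * ((((L : ℝ) ^ d)⁻¹) ^ j) ^ 2 else 0)))
    (S : Finset (Fin d → ℤ))
    (hfull : ∀ j, j ≤ m → ∀ x ∈ S, blockMap (L ^ j) x ∈ Λs j → ∀ z, blockMap (L ^ j) z = blockMap (L ^ j) x → z ∈ S)
    (hdisj : ∀ x ∈ S, ∀ j, j ≤ m → ∀ j', j' ≤ m → blockMap (L ^ j) x ∈ Λs j → blockMap (L ^ j') x ∈ Λs j' → j = j')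
    (hcover : ∀ x ∈ S, ∃ j, j ≤ m ∧ blockMap (L ^ j) x ∈ Λs j)
    (ρ : (Fin d → ℤ) → ℝ) {θ : ℝ} (hθ : 0 ≤ θ) (hθ1 : θ < 1)
    (hρ1 : ∀ x ∈ S, ∀ j, j ≤ m → blockMap (L ^ j) x ∈ Λs j → ∀ μ : Fin d,
      (x + e μ ∈ S → 4 * (d : ℝ) * (Real.cosh (ρ x - ρ (x + e μ)) - 1) ≤ θ * min 8 (a j * η ^ 2 * ((L : ℝ) ^ j) ^ 2 * (((L : ℝ) ^ d) ^ j)⁻¹) * (((L : ℝ) ^ j) ^ 2)⁻¹) ∧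
      (x - e μ ∈ S → 4 * (d : ℝ) * (Real.cosh (ρ x - ρ (x - e μ)) - 1) ≤ θ * min 8 (a j * η ^ 2 * ((L : ℝ) ^ j) ^ 2 * (((L : ℝ) ^ d) ^ j)⁻¹) * (((L : ℝ) ^ j) ^ 2)⁻¹))
    (hρ2 : ∀ x ∈ S, ∀ j, j ≤ m → blockMap (L ^ j) x ∈ Λs j → ∀ z ∈ S, blockMap (L ^ j) z = blockMap (L ^ j) x →
      2 * (a j * η ^ 2 * ((L : ℝ) ^ j) ^ 2 * (((L : ℝ) ^ d) ^ j)⁻¹) * (Real.cosh (ρ x - ρ z) - 1) ≤ θ * min 8 (a j * η ^ 2 * ((L : ℝ) ^ j) ^ 2 * (((L : ℝ) ^ d) ^ j)⁻¹))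
    (g f : (Fin d → ℤ) → ℝ) (hg : ∀ w, w ∉ S → g w = 0) (hKg : ∀ x ∈ S, ∑ z ∈ S, K x z * g z = f x) :
    (1 - θ) ^ 2 * ∑ x ∈ S, (fun x => ∑ j ∈ Finset.range (m + 1), (if blockMap (L ^ j) x ∈ Λs j then min 8 (a j * η ^ 2 * ((L : ℝ) ^ j) ^ 2 * (((L : ℝ) ^ d) ^ j)⁻¹) * (((L : ℝ) ^ j * η) ^ 2)⁻¹ else 0)) x * Real.exp (2 * ρ x) * g x ^ 2
      ≤ ∑ x ∈ S, ((fun x => ∑ j ∈ Finset.range (m + 1), (if blockMap (L ^ j) x ∈ Λs j then min 8 (a j * η ^ 2 * ((L : ℝ) ^ j) ^ 2 * (((L : ℝ) ^ d) ^ j)⁻¹) * (((L : ℝ) ^ j * η) ^ 2)⁻¹ else 0)) x)⁻¹ * Real.exp (2 * ρ x) * f x ^ 2 := by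
  have ha0 : ∀ j, 0 ≤ a j := fun j => (ha j).le
  refine agmon_solve S K (fun x _ z _ => flatKernel_symm L m Λs a K hK x z) ρ _
    (siteWeight_pos hη hL m Λs a ha S hcover) hθ1
    (fun x hx => rowBound_flatDirichlet hη hL m Λs a ha0 K hK S hfull hcover ρ hθ hρ1 hρ2 x hx) g f hKg ?_
  have hv : ∀ w, w ∉ S → (fun x => Real.exp (ρ x) * g x) w = 0 := fun w hw => by simp only [hg w hw, mul_zero]
  have h1 := weighted_coercive_flatDirichlet hη hL m Λs a K hK S (fun x => Real.exp (ρ x) * g x) hv hfull hdisj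
  rw [← siteWeight_sum_eq L m Λs a S (fun x => Real.exp (ρ x) * g x)] at h1
  exact h1

/-- **Every site of `□₀` lies in a tower block of the truncation-`n` restriction sets** (`n ≤ k`): `∃ j ≤ n, Bʲ(x) ∈ Λs_n(j)` — below `n` the level of `x` in
the full tower, at `n` the traced cube `□_n^{(n)}`. [cite: Balaban1985RegularSpaces, (1.5)–(1.6) p.77, (1.68) p.88, (1.131) p.99] -/
theorem cover_cubeMember {L : ℕ} (hL : 1 ≤ L) (a : Fin d → ℤ) (M : ℕ) {ρ : ℕ} (hρ : L ≤ ρ) {k n : ℕ} (hn : n ≤ k)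
    (x : Fin d → ℤ) (hx : x ∈ cubeFam false L a M ρ k 0) : ∃ j, j ≤ n ∧ blockMap (L ^ j) x ∈ cubeLamS L a M ρ k n j := by
  obtain ⟨j, hjk, y, hy, hbox⟩ := hpart_cubeLam hL a M ρ k x hx
  have hunder : Under L j y x := (inBox_tower_iff_under L j y x).1 hbox
  have hbm : blockMap (L ^ j) x = y := (under_iff_blockMap_eq hL j y x).1 hunder
  by_cases hjn : j < n
  · refine ⟨j, hjn.le, ?_⟩
    rw [cubeLamS_of_lt L a M ρ k hjn, hbm]
    rcases lt_or_eq_of_le hjk with hlt | heq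
    · rwa [cubeLamS_of_lt L a M ρ k hlt] at hy
    · subst heq
      exact absurd hjn (not_lt.mpr hn)
  · have hnj : n ≤ j := not_lt.mp hjn
    refine ⟨n, le_rfl, ?_⟩
    -- `x ∈ □_j ⊂ □_n`, and `□_n = Bⁿ(□_n^{(n)})`
    have hxj : x ∈ cube L a M ρ k j := (mem_cube_iff hL).mpr ⟨y, inBox_sq_of_mem_cubeLamS hy, hunder⟩
    have hxn : x ∈ cube L a M ρ k n := by
      have h := cubeFam_antitone hL a M hρ k hnj
      rw [cubeFam_false_of_le L a M ρ hjk, cubeFam_false_of_le L a M ρ hn] at h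
      exact h hxj
    obtain ⟨z, hz, hzx⟩ := (mem_cube_iff hL).mp hxn
    rw [cubeLamS_self, (under_iff_blockMap_eq hL n z x).1 hzx]
    exact hz

open Classical in
/-- **THE AGMON SOLVE AT THE CONCRETE CUBE MEMBER `{□_j}`** — the letters `S = □₀`, `K` at `(η, L, n, cubeLamS, w)` of
`B8Prop6CubeMemberFlatScalar.prop6_cubeMember_flat_of_real` (`w_j > 0`, `n ≤ k`): for `Kg = f` on `□₀` and an exponent `ρ` obeying `hρ1`∕`hρ2`,
`(1 − θ)²·Σ_{□₀} ω e^{2ρ} g² ≤ Σ_{□₀} ω⁻¹ e^{2ρ} f²`; the three geometric hypotheses are DISCHARGED (`towerBlock_subset_cube`, `towers_disjoint_cube`, `cover_cubeMember`).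
[cite: Balaban1985RegularSpaces, (1.101) p.93, (1.131) p.99; Balaban1984PropagatorsII, p.228; Balaban1984PropagatorsI, p.36] -/
theorem agmon_solve_cubeMember {η : ℝ} (hη : η ≠ 0) {L : ℕ} (hL : 1 ≤ L) (a : Fin d → ℤ) (M : ℕ) {ρc : ℕ} (hρc : L ≤ ρc)
    {k n : ℕ} (hn : n ≤ k) (w : ℕ → ℝ) (hw : ∀ j, 0 < w j) (S : Finset (Fin d → ℤ)) (hS : ∀ x, x ∈ S ↔ x ∈ cubeFam false L a M ρc k 0)
    (K : (Fin d → ℤ) → (Fin d → ℤ) → ℝ)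
    (hK : ∀ x z, K x z = ((η ^ 2)⁻¹ * ∑ μ : Fin d, ((2 : ℝ) * (if z = x then (1 : ℝ) else 0) - (if z = x + e μ then (1 : ℝ) else 0)
        - (if z = x - e μ then (1 : ℝ) else 0))) +
        (∑ j ∈ Finset.range (n + 1), (if blockMap (L ^ j) x ∈ cubeLamS L a M ρc k n j ∧ blockMap (L ^ j) z = blockMap (L ^ j) x then
          w j * ((((L : ℝ) ^ d)⁻¹) ^ j) ^ 2 else 0)))
    (ρ : (Fin d → ℤ) → ℝ) {θ : ℝ} (hθ : 0 ≤ θ) (hθ1 : θ < 1)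
    (hρ1 : ∀ x ∈ S, ∀ j, j ≤ n → blockMap (L ^ j) x ∈ cubeLamS L a M ρc k n j → ∀ μ : Fin d,
      (x + e μ ∈ S → 4 * (d : ℝ) * (Real.cosh (ρ x - ρ (x + e μ)) - 1)
        ≤ θ * min 8 (w j * η ^ 2 * ((L : ℝ) ^ j) ^ 2 * (((L : ℝ) ^ d) ^ j)⁻¹) * (((L : ℝ) ^ j) ^ 2)⁻¹) ∧
      (x - e μ ∈ S → 4 * (d : ℝ) * (Real.cosh (ρ x - ρ (x - e μ)) - 1)
        ≤ θ * min 8 (w j * η ^ 2 * ((L : ℝ) ^ j) ^ 2 * (((L : ℝ) ^ d) ^ j)⁻¹) * (((L : ℝ) ^ j) ^ 2)⁻¹))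
    (hρ2 : ∀ x ∈ S, ∀ j, j ≤ n → blockMap (L ^ j) x ∈ cubeLamS L a M ρc k n j → ∀ z ∈ S, blockMap (L ^ j) z = blockMap (L ^ j) x →
      2 * (w j * η ^ 2 * ((L : ℝ) ^ j) ^ 2 * (((L : ℝ) ^ d) ^ j)⁻¹) * (Real.cosh (ρ x - ρ z) - 1)
        ≤ θ * min 8 (w j * η ^ 2 * ((L : ℝ) ^ j) ^ 2 * (((L : ℝ) ^ d) ^ j)⁻¹))
    (g f : (Fin d → ℤ) → ℝ) (hg : ∀ x, x ∉ S → g x = 0) (hKg : ∀ x ∈ S, ∑ z ∈ S, K x z * g z = f x) :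
    (1 - θ) ^ 2 * ∑ x ∈ S, (∑ j ∈ Finset.range (n + 1), (if blockMap (L ^ j) x ∈ cubeLamS L a M ρc k n j then
        min 8 (w j * η ^ 2 * ((L : ℝ) ^ j) ^ 2 * (((L : ℝ) ^ d) ^ j)⁻¹) * (((L : ℝ) ^ j * η) ^ 2)⁻¹ else 0)) * Real.exp (2 * ρ x) * g x ^ 2
      ≤ ∑ x ∈ S, (∑ j ∈ Finset.range (n + 1), (if blockMap (L ^ j) x ∈ cubeLamS L a M ρc k n j then
        min 8 (w j * η ^ 2 * ((L : ℝ) ^ j) ^ 2 * (((L : ℝ) ^ d) ^ j)⁻¹) * (((L : ℝ) ^ j * η) ^ 2)⁻¹ else 0))⁻¹ * Real.exp (2 * ρ x) * f x ^ 2 :=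
  agmon_solve_flatDirichlet hη hL n (cubeLamS L a M ρc k n) w hw K hK S
    (fun _ hj _ _ hxj z hz => (hS z).mpr (towerBlock_subset_cube hL a M hρc hn hj hxj hz))
    (fun x hx j hj j' hj' h1 h2 => (towers_disjoint_cube hL a M hρc hn j hj j' hj' _ h1 _ h2 x ((hS x).mp hx) rfl rfl).1)
    (fun x hx => cover_cubeMember hL a M hρc hn x ((hS x).mp hx)) ρ hθ hθ1 hρ1 hρ2 g f hg hKg

end Literature.MathematicalPhysics.QuantumFieldTheory.Balaban1983to89.B8Eq191FlatDirichletConjugation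

end
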